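import Literature.Probability.RandomPlanarGeometry.SquaredWalkPolygons
import Literature.Probability.RandomPlanarGeometry.SAWCount
import Literature.Probability.Percolation.LatticeSymmetry
import HarnessLib

/-!
# Lemma 5 of Duminil-Copin–Kozma–Yadin 2014 from its Step 1: two rectangle walks make a
# squared walk

Topic `Literature/Probability/RandomPlanarGeometry` (continues `SupercriticalSAWPolygons.lean` and
`SquaredWalkPolygons.lean`). Source: H. Duminil-Copin, G. Kozma, A. Yadin, *Supercritical
self-avoiding walks are space-filling*, Ann. IHP Probab. Stat. 50 (2014) 315–326
(arXiv:1110.3074), §2, Lemma 5 ("For `c` sufficiently large and `n` even, the number `aₙ` of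
squared walks of length `n` satisfies `aₙ ≥ μⁿ e^{-c√n}`") and its printed proof:

* Step 1 (Rectangles): "Let `Σₙ` be the set of `n`-step self-avoiding walks for which there
  exists `(k,l)` such that `γ₀ = (0,0)`, `γₙ = (k,l)` and `γ ⊂ [0,k]×[0,l]`" … [unfolding a
  bridge by iterated reflections, an `e^{c√n}`-to-one map by Hardy–Ramanujan] … "the
  cardinality of `Σₙ` is thus larger than `e^{-c√n} bₙ ≥ e^{-2c√n} μⁿ`."
* Step 2 (Squares): "There exist `k, l ≤ n` such that the number of elements of `Σₙ` with
  `(k,l)` as an ending point is larger than `e^{-2c√n}μⁿ/n²`. By taking two arbitrary walks of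
  `Σₙ` ending at `(k,l)`, one can construct a `2n`-step self-avoiding walk with `γ₀ = (0,0)` and
  `γ₂ₙ = (k+l,k+l)` contained in `[0,k+l]²` by reflecting orthogonally to `e^{iπ/4}ℝ` the first
  walk, and then concatenating the two. We deduce that `a₂ₙ ≥ μ²ⁿe^{-4c√n}/n⁴`. This shows the
  lemma for `n` sufficiently large, and one can increase `c` if necessary to handle all even `n`."

This file vendors the rectangle walks `Σₙ` (`IsRectangleWalk`, `rectangleWalkCount n = #Σₙ`,
counted like `count`/`bridgeCount`/`squaredWalkCount` over the endpoints in the box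
`{-n,…,n}²`, which contains all of them), records the conclusion of Step 1 as the named fact
`DKY2014_lem5_step1` (its printed proof is the Hammersley–Welsh-type unfolding resting on the
bridge bound (2.1), `DKY2014_eq21`), and PROVES Step 2: the map
`(ω₁, ω₂) ↦ (ω₁ reflected in the diagonal) · (ω₂ + (l,k))` (`squaredOfPair`) sends pairs of
rectangle walks ending at `(k,l)` injectively to squared walks of span `k+l` and length `2n`
(`isSquaredWalk_squaredOfPair`, `squaredOfPair_injective`), whence
`a₂ₙ ≥ (#Σₙ/(2n+1)²)²` (`exists_kl_rectangleWalkCount_le` with `sq_card_rectangleWalksTo_le`) and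
**`DKY2014_lem5_of_step1 : DKY2014_lem5_step1 → DKY2014_lem5`** (with `c ↦ 2|c| + 14`).
The printed Step 1 in its sharper bridge form `#Σₙ ≥ e^{-c√n} bₙ` is the named fact
`DKY2014_lem5_step1_bridge`, from which `DKY2014_lem5_step1` follows given (2.1)
(`DKY2014_lem5_step1_of_bridge`), so that the Hammersley–Welsh bound `DKY2014_eq21` is the only
bridge input of the DAG.
Tree anchors: `transposeIso` (`LatticeSymmetry.lean`, the reflection in the diagonal),
`zdShiftIso` (`SiteConnectionTools.lean`), `eq_of_isPath_of_edges_toFinset_eq` and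
`SquaredWalkPolygon.copy_map_injective` (`SquaredWalkPolygons.lean`).
-/

noncomputable section

open Filter Topology SimpleGraph Literature.Probability.LatticeModels Literature.Probability.Percolation
open scoped BigOperators

namespace Literature.Probability.RandomPlanarGeometry.SAW

/-! ### Rectangle walks `Σₙ` and Step 1 of the proof of Lemma 5 -/

/-- A **rectangle walk**: a self-avoiding walk `γ` of `ℤ²` with `γ₀ = (0,0)`, `γₙ = (k,l)` and
`γ ⊂ [0,k]×[0,l]`, i.e. contained in the rectangle spanned by its endpoints (an element of the
set `Σₙ` of the source). [cite: DuminilCopinKozmaYadin2014, Lemma 5 (proof, Step 1: definition of Σₙ)] -/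
def IsRectangleWalk {v : Site 2} (p : (zdGraph 2).Walk (0 : Site 2) v) : Prop :=
  p.IsPath ∧ ∀ w ∈ p.support, ∀ i, 0 ≤ w i ∧ w i ≤ v i

open Classical in
/-- `#Σₙ`, the number of `n`-step rectangle walks. As for `count`, the sum over endpoints is
restricted to the box `{-n,…,n}²`, which contains all of them.
[cite: DuminilCopinKozmaYadin2014, Lemma 5 (proof, Step 1: definition of Σₙ)] -/
def rectangleWalkCount (n : ℕ) : ℕ :=
  ∑ v ∈ box 2 n,
    (((zdGraph 2).finsetWalkLength n (0 : Site 2) v).filter fun p => IsRectangleWalk p).card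

/-- **Step 1 of the printed proof of Lemma 5** (named fact): "the cardinality of `Σₙ` is thus
larger than `e^{-c√n} bₙ ≥ e^{-2c√n} μⁿ`" — for some constant `c`, `#Σₙ ≥ e^{-c√n} μⁿ` for every
`n`, `μ = connectiveConstant`. (Printed proof: a bridge is unfolded, by iterated reflections of
initial and final pieces of strictly monotone widths, into a walk contained in the rectangle
spanned by its endpoints; given the image, the widths — two strictly decreasing sequences
partitioning an integer `≤ n` — determine the bridge, so the map is at most `e^{c√n}`-to-one by
Hardy–Ramanujan (Theorem 4), and `bₙ ≥ e^{-c√n}μⁿ` by (2.1), `DKY2014_eq21`.)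
[cite: DuminilCopinKozmaYadin2014, Lemma 5 (proof, Step 1)] -/
def DKY2014_lem5_step1 : Prop :=
  ∃ c : ℝ, ∀ n : ℕ, Real.exp (-(c * Real.sqrt n)) * connectiveConstant ^ n ≤ rectangleWalkCount n

/-! ### Step 2: two rectangle walks ending at `(k,l)` make a squared walk of span `k+l` -/

namespace RectanglePair

variable (k l : ℕ)

/-- The endpoint `(k,l)`. [cite: DuminilCopinKozmaYadin2014, Lemma 5 (proof, Step 2)] -/
def kl : Site 2 := ![(k : ℤ), l]

/-- The junction `(l,k)` (the reflected endpoint). [cite: DuminilCopinKozmaYadin2014, Lemma 5 (proof, Step 2)] -/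
def lk : Site 2 := ![(l : ℤ), k]

/-- The first walk reflected in the diagonal ("reflecting orthogonally to `e^{iπ/4}ℝ`"): from
`(0,0)` to `(l,k)`, inside `[0,l]×[0,k]`. [cite: DuminilCopinKozmaYadin2014, Lemma 5 (proof, Step 2)] -/
def firstHalf (ω : (zdGraph 2).Walk (0 : Site 2) (kl k l)) : (zdGraph 2).Walk (0 : Site 2) (lk k l) :=
  (ω.map transposeIso.toHom).copy (by simp) (by funext i; fin_cases i <;> simp [kl, lk, zdSignedPermIso])

/-- The second walk translated by `(l,k)`: from `(l,k)` to `(k+l,k+l)`, inside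
`[l,k+l]×[k,k+l]`. [cite: DuminilCopinKozmaYadin2014, Lemma 5 (proof, Step 2)] -/
def secondHalf (ω : (zdGraph 2).Walk (0 : Site 2) (kl k l)) :
    (zdGraph 2).Walk (lk k l) (diag (k + l)) :=
  (ω.map (zdShiftIso (lk k l)).toHom).copy (by simp)
    (by funext i; fin_cases i
        · simp [kl, lk, diag]
        · simp [kl, lk, diag]; ring)

/-- **The squared walk made of two rectangle walks**: the reflected first walk followed by the
translated second walk, a walk from `(0,0)` to `(k+l,k+l)`.
[cite: DuminilCopinKozmaYadin2014, Lemma 5 (proof, Step 2)] -/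
def squaredOfPair (ω₁ ω₂ : (zdGraph 2).Walk (0 : Site 2) (kl k l)) :
    (zdGraph 2).Walk (0 : Site 2) (diag (k + l)) :=
  (firstHalf k l ω₁).append (secondHalf k l ω₂)

variable {k l}

/-- Vertices of the reflected first walk: `0 ≤ w₀ ≤ l`, `0 ≤ w₁ ≤ k`.
[cite: DuminilCopinKozmaYadin2014, Lemma 5 (proof, Step 2)] -/
theorem mem_support_firstHalf {ω : (zdGraph 2).Walk (0 : Site 2) (kl k l)} (hω : IsRectangleWalk ω)
    {w : Site 2} (hw : w ∈ (firstHalf k l ω).support) :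
    (0 ≤ w 0 ∧ w 0 ≤ l) ∧ (0 ≤ w 1 ∧ w 1 ≤ k) := by
  rw [firstHalf, Walk.support_copy, Walk.support_map, List.mem_map] at hw
  obtain ⟨u, hu, rfl⟩ := hw
  have h0 := hω.2 u hu 0
  have h1 := hω.2 u hu 1
  simp only [kl, Matrix.cons_val_zero, Matrix.cons_val_one] at h0 h1
  simp [Iso.toHom, zdSignedPermIso]
  omega

/-- Vertices of the translated second walk: `l ≤ w₀ ≤ k+l`, `k ≤ w₁ ≤ k+l`.
[cite: DuminilCopinKozmaYadin2014, Lemma 5 (proof, Step 2)] -/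
theorem mem_support_secondHalf {ω : (zdGraph 2).Walk (0 : Site 2) (kl k l)}
    (hω : IsRectangleWalk ω) {w : Site 2} (hw : w ∈ (secondHalf k l ω).support) :
    ((l : ℤ) ≤ w 0 ∧ w 0 ≤ k + l) ∧ ((k : ℤ) ≤ w 1 ∧ w 1 ≤ k + l) := by
  rw [secondHalf, Walk.support_copy, Walk.support_map, List.mem_map] at hw
  obtain ⟨u, hu, rfl⟩ := hw
  have h0 := hω.2 u hu 0
  have h1 := hω.2 u hu 1
  simp only [kl, Matrix.cons_val_zero, Matrix.cons_val_one] at h0 h1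
  simp [Iso.toHom, lk]
  omega

/-- Appending two paths which meet only at the junction gives a path. [folklore] -/
theorem isPath_append_of_inter {V : Type*} {G : SimpleGraph V} {a b c : V} {p : G.Walk a b}
    {q : G.Walk b c} (hp : p.IsPath) (hq : q.IsPath)
    (h : ∀ x ∈ p.support, x ∈ q.support → x = b) : (p.append q).IsPath := by
  rw [Walk.isPath_def, Walk.support_append, List.nodup_append]
  have hqn : q.support.Nodup := (Walk.isPath_def _).1 hq
  have hq' : q.support = b :: q.support.tail := by
    cases q with
    | nil => rfl
    | cons _ _ => rfl
  rw [hq'] at hqn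
  refine ⟨(Walk.isPath_def _).1 hp, hqn.of_cons, fun x hx y hy hxy => ?_⟩
  subst hxy
  have hxq : x ∈ q.support := by rw [hq']; exact List.mem_cons_of_mem _ hy
  have := h x hx hxq
  subst this
  exact (List.nodup_cons.1 hqn).1 hy

/-- **The walk made of two rectangle walks is a squared walk** of span `k+l` (self-avoiding —
the two halves live in `[0,l]×[0,k]` and `[l,k+l]×[k,k+l]`, which meet only at the junction
`(l,k)` — and contained in `[0,k+l]²`). [cite: DuminilCopinKozmaYadin2014, Lemma 5 (proof, Step 2)] -/
theorem isSquaredWalk_squaredOfPair {ω₁ ω₂ : (zdGraph 2).Walk (0 : Site 2) (kl k l)}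
    (h₁ : IsRectangleWalk ω₁) (h₂ : IsRectangleWalk ω₂) :
    IsSquaredWalk (squaredOfPair k l ω₁ ω₂) := by
  have hp₁ : (firstHalf k l ω₁).IsPath :=
    (Walk.isPath_copy _ _ _).2 (h₁.1.map (RelIso.injective _))
  have hp₂ : (secondHalf k l ω₂).IsPath :=
    (Walk.isPath_copy _ _ _).2 (h₂.1.map (RelIso.injective _))
  refine ⟨isPath_append_of_inter hp₁ hp₂ fun x hx hx' => ?_, k + l, rfl, fun w hw i => ?_⟩
  · have a := mem_support_firstHalf h₁ hx
    have b := mem_support_secondHalf h₂ hx'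
    funext i; fin_cases i <;> simp [lk] <;> omega
  · rw [squaredOfPair, Walk.support_append, List.mem_append] at hw
    rcases hw with hw | hw
    · have := mem_support_firstHalf h₁ hw
      fin_cases i <;> simp <;> omega
    · have := mem_support_secondHalf h₂ (List.mem_of_mem_tail hw)
      fin_cases i <;> simp <;> omega

/-- The walk made of two `n`-step rectangle walks has `2n` steps.
[cite: DuminilCopinKozmaYadin2014, Lemma 5 (proof, Step 2)] -/
theorem length_squaredOfPair (ω₁ ω₂ : (zdGraph 2).Walk (0 : Site 2) (kl k l)) :
    (squaredOfPair k l ω₁ ω₂).length = ω₁.length + ω₂.length := by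
  rw [squaredOfPair, Walk.length_append, firstHalf, secondHalf, Walk.length_copy, Walk.length_copy,
    Walk.length_map, Walk.length_map]

open Classical in
/-- The edges of a set of edges all of whose endpoints lie in the closed lower-left region
`{w₀ ≤ l, w₁ ≤ k}` (`lower = true`) resp. upper-right region `{l ≤ w₀, k ≤ w₁}`
(`lower = false`). [folklore] -/
def halfEdges (k l : ℕ) (lower : Bool) (E : Finset (Sym2 (Site 2))) : Finset (Sym2 (Site 2)) :=
  E.filter fun e => ∀ x ∈ e,
    if lower then x 0 ≤ (l : ℤ) ∧ x 1 ≤ (k : ℤ) else (l : ℤ) ≤ x 0 ∧ (k : ℤ) ≤ x 1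

/-- The two regions recover the two halves from the edge set of the squared walk: an edge with
both endpoints in both regions would be a loop at the junction `(l,k)`.
[cite: DuminilCopinKozmaYadin2014, Lemma 5 (proof, Step 2)] -/
theorem halfEdges_squaredOfPair {ω₁ ω₂ : (zdGraph 2).Walk (0 : Site 2) (kl k l)}
    (h₁ : IsRectangleWalk ω₁) (h₂ : IsRectangleWalk ω₂) :
    halfEdges k l true (squaredOfPair k l ω₁ ω₂).edges.toFinset =
        (firstHalf k l ω₁).edges.toFinset ∧
      halfEdges k l false (squaredOfPair k l ω₁ ω₂).edges.toFinset =
        (secondHalf k l ω₂).edges.toFinset := by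
  classical
  have key : ∀ (lower : Bool),
      halfEdges k l lower (squaredOfPair k l ω₁ ω₂).edges.toFinset =
        if lower then (firstHalf k l ω₁).edges.toFinset
        else (secondHalf k l ω₂).edges.toFinset := by
    intro lower
    rw [squaredOfPair, Walk.edges_append, List.toFinset_append, halfEdges, Finset.filter_union]
    -- edges of the first half: kept by `lower`, discarded by `upper`; symmetrically
    have hA : ∀ e ∈ (firstHalf k l ω₁).edges.toFinset, ∀ x ∈ e, x 0 ≤ (l : ℤ) ∧ x 1 ≤ (k : ℤ) :=
      fun e he x hx => by
        have := mem_support_firstHalf h₁ (mem_support_of_mem_edges' _ (List.mem_toFinset.1 he) hx)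
        exact ⟨this.1.2, this.2.2⟩
    have hB : ∀ e ∈ (secondHalf k l ω₂).edges.toFinset, ∀ x ∈ e,
        (l : ℤ) ≤ x 0 ∧ (k : ℤ) ≤ x 1 := fun e he x hx => by
      have := mem_support_secondHalf h₂ (mem_support_of_mem_edges' _ (List.mem_toFinset.1 he) hx)
      exact ⟨this.1.1, this.2.1⟩
    -- no edge has both endpoints in both regions
    have hAB : ∀ e ∈ (zdGraph 2).edgeSet, (∀ x ∈ e, x 0 ≤ (l : ℤ) ∧ x 1 ≤ (k : ℤ)) →
        (∀ x ∈ e, (l : ℤ) ≤ x 0 ∧ (k : ℤ) ≤ x 1) → False := by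
      intro e he hlo hhi
      induction e using Sym2.ind with
      | _ a b =>
        have hab : a ≠ b := ((SimpleGraph.mem_edgeSet _).1 he).ne
        apply hab
        have ha := And.intro (hlo a (Sym2.mem_mk_left a b)) (hhi a (Sym2.mem_mk_left a b))
        have hb := And.intro (hlo b (Sym2.mem_mk_right a b)) (hhi b (Sym2.mem_mk_right a b))
        funext i; fin_cases i <;> simp <;> omega
    cases lower
    · simp only [Bool.false_eq_true, ↓reduceIte]
      rw [Finset.filter_false_of_mem, Finset.filter_true_of_mem hB, Finset.empty_union]
      intro e he hhi
      exact hAB e (Walk.edges_subset_edgeSet _ (List.mem_toFinset.1 he)) (hA e he) hhi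
    · simp only [↓reduceIte]
      rw [Finset.filter_true_of_mem hA, Finset.filter_false_of_mem, Finset.union_empty]
      intro e he hlo
      exact hAB e (Walk.edges_subset_edgeSet _ (List.mem_toFinset.1 he)) hlo (hB e he)
  exact ⟨key true, key false⟩

/-- **The pair of rectangle walks is recovered from the squared walk**: the construction is
injective. [cite: DuminilCopinKozmaYadin2014, Lemma 5 (proof, Step 2)] -/
theorem squaredOfPair_injective {ω₁ ω₂ ω₁' ω₂' : (zdGraph 2).Walk (0 : Site 2) (kl k l)}
    (h₁ : IsRectangleWalk ω₁) (h₂ : IsRectangleWalk ω₂) (h₁' : IsRectangleWalk ω₁')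
    (h₂' : IsRectangleWalk ω₂') (h : squaredOfPair k l ω₁ ω₂ = squaredOfPair k l ω₁' ω₂') :
    ω₁ = ω₁' ∧ ω₂ = ω₂' := by
  obtain ⟨e₁, e₂⟩ := halfEdges_squaredOfPair h₁ h₂
  obtain ⟨e₁', e₂'⟩ := halfEdges_squaredOfPair h₁' h₂'
  rw [h] at e₁ e₂
  have p₁ : (firstHalf k l ω₁).IsPath := (Walk.isPath_copy _ _ _).2 (h₁.1.map (RelIso.injective _))
  have p₁' : (firstHalf k l ω₁').IsPath :=
    (Walk.isPath_copy _ _ _).2 (h₁'.1.map (RelIso.injective _))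
  have p₂ : (secondHalf k l ω₂).IsPath := (Walk.isPath_copy _ _ _).2 (h₂.1.map (RelIso.injective _))
  have p₂' : (secondHalf k l ω₂').IsPath :=
    (Walk.isPath_copy _ _ _).2 (h₂'.1.map (RelIso.injective _))
  exact ⟨SquaredWalkPolygon.copy_map_injective _ _ _
      (eq_of_isPath_of_edges_toFinset_eq p₁ p₁' (e₁.symm.trans e₁')),
    SquaredWalkPolygon.copy_map_injective _ _ _
      (eq_of_isPath_of_edges_toFinset_eq p₂ p₂' (e₂.symm.trans e₂'))⟩

end RectanglePair

/-! ### Counting: `a₂ₙ ≥ (#Σₙ/(2n+1)²)²` and Lemma 5 from Step 1 -/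

open RectanglePair

open Classical in
/-- The `n`-step rectangle walks ending at `v`. [cite: DuminilCopinKozmaYadin2014, Lemma 5 (proof, Step 2)] -/
def rectangleWalksTo (n : ℕ) (v : Site 2) : Finset ((zdGraph 2).Walk (0 : Site 2) v) :=
  ((zdGraph 2).finsetWalkLength n 0 v).filter fun p => IsRectangleWalk p

/-- Membership in `rectangleWalksTo`. [cite: DuminilCopinKozmaYadin2014, Lemma 5 (proof, Step 2)] -/
theorem mem_rectangleWalksTo {n : ℕ} {v : Site 2} {p : (zdGraph 2).Walk (0 : Site 2) v} :
    p ∈ rectangleWalksTo n v ↔ p.length = n ∧ IsRectangleWalk p := by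
  classical
  rw [rectangleWalksTo, Finset.mem_filter, mem_finsetWalkLength_iff]

/-- `#Σₙ` is the sum over the endpoints of the numbers of rectangle walks.
[cite: DuminilCopinKozmaYadin2014, Lemma 5 (proof, Step 1: definition of Σₙ)] -/
theorem rectangleWalkCount_eq (n : ℕ) :
    rectangleWalkCount n = ∑ v ∈ box 2 n, (rectangleWalksTo n v).card := rfl

/-- "There exist `k, l ≤ n` such that the number of elements of `Σₙ` with `(k,l)` as an ending
point is larger than" the average `#Σₙ/(2n+1)²` (pigeonhole over the `(2n+1)²` endpoints of the
box; an endpoint carrying a rectangle walk has non-negative coordinates).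
[cite: DuminilCopinKozmaYadin2014, Lemma 5 (proof, Step 2)] -/
theorem exists_kl_rectangleWalkCount_le {n : ℕ} (hpos : 0 < rectangleWalkCount n) :
    ∃ k l : ℕ, k ≤ n ∧ l ≤ n ∧
      rectangleWalkCount n ≤ (2 * n + 1) ^ 2 * (rectangleWalksTo n (kl k l)).card := by
  classical
  have hbox : (box 2 n).Nonempty := ⟨0, by simp [mem_box]⟩
  obtain ⟨v, hv, hle⟩ : ∃ v ∈ box 2 n,
      rectangleWalkCount n ≤ (box 2 n).card * (rectangleWalksTo n v).card := by
    have h : ∑ _v ∈ box 2 n, rectangleWalkCount n ≤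
        ∑ v ∈ box 2 n, (box 2 n).card * (rectangleWalksTo n v).card := by
      rw [Finset.sum_const, smul_eq_mul, ← Finset.mul_sum, ← rectangleWalkCount_eq]
    exact Finset.exists_le_of_sum_le hbox h
  rw [card_box] at hle
  -- the chosen endpoint carries a rectangle walk, so its coordinates are in `[0, n]`
  have hne : (rectangleWalksTo n v).Nonempty := by
    rw [← Finset.card_pos]
    by_contra h0
    rw [not_lt, Nat.le_zero] at h0
    rw [h0, mul_zero] at hle
    omega
  obtain ⟨p, hp⟩ := hne
  obtain ⟨-, -, hrect⟩ := mem_rectangleWalksTo.1 hp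
  have h0 := hrect 0 p.start_mem_support
  simp only [Pi.zero_apply, le_refl, true_and] at h0
  obtain ⟨k, hk⟩ := Int.eq_ofNat_of_zero_le (h0 0)
  obtain ⟨l, hl⟩ := Int.eq_ofNat_of_zero_le (h0 1)
  have hv' : v = kl k l := by
    funext i; fin_cases i
    · simpa [kl] using hk
    · simpa [kl] using hl
  subst hv'
  rw [mem_box] at hv
  have hvk := hv 0
  have hvl := hv 1
  simp only [kl, Matrix.cons_val_zero, Matrix.cons_val_one] at hvk hvl
  exact ⟨k, l, by omega, by omega, hle⟩

/-- **`a₂ₙ ≥ (number of n-step rectangle walks ending at (k,l))²`** for `k, l ≤ n`: pairs of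
such walks give distinct squared walks of span `k+l` and length `2n`
(`isSquaredWalk_squaredOfPair`, `squaredOfPair_injective`), whose endpoint `(k+l,k+l)` lies
in the box `{-2n,…,2n}²` over which `squaredWalkCount (2n)` sums.
[cite: DuminilCopinKozmaYadin2014, Lemma 5 (proof, Step 2: "We deduce that a₂ₙ ≥ μ²ⁿe^{-4c√n}/n⁴")] -/
theorem sq_card_rectangleWalksTo_le {n k l : ℕ} (hk : k ≤ n) (hl : l ≤ n) :
    (rectangleWalksTo n (kl k l)).card ^ 2 ≤ squaredWalkCount (2 * n) := by
  classical
  set R := rectangleWalksTo n (kl k l) with hR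
  set T := ((zdGraph 2).finsetWalkLength (2 * n) (0 : Site 2) (diag (k + l))).filter
    fun p => IsSquaredWalk p with hT
  -- the pair map lands in `T` and is injective on `R × R`
  have hmem : ∀ {p}, p ∈ R → IsRectangleWalk p ∧ p.length = n := fun hp =>
    ⟨(mem_rectangleWalksTo.1 hp).2, (mem_rectangleWalksTo.1 hp).1⟩
  have himage : (R ×ˢ R).image (fun q => squaredOfPair k l q.1 q.2) ⊆ T := by
    intro w hw
    obtain ⟨q, hq, rfl⟩ := Finset.mem_image.1 hw
    obtain ⟨hq1, hq2⟩ := Finset.mem_product.1 hq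
    rw [hT, Finset.mem_filter, mem_finsetWalkLength_iff]
    exact ⟨by rw [length_squaredOfPair, (hmem hq1).2, (hmem hq2).2]; ring,
      isSquaredWalk_squaredOfPair (hmem hq1).1 (hmem hq2).1⟩
  have hinj : Set.InjOn (fun q : (zdGraph 2).Walk (0 : Site 2) (kl k l) ×
      (zdGraph 2).Walk (0 : Site 2) (kl k l) => squaredOfPair k l q.1 q.2) ↑(R ×ˢ R) := by
    intro q hq q' hq' h
    obtain ⟨hq1, hq2⟩ := Finset.mem_product.1 (Finset.mem_coe.1 hq)
    obtain ⟨hq1', hq2'⟩ := Finset.mem_product.1 (Finset.mem_coe.1 hq')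
    obtain ⟨e1, e2⟩ := squaredOfPair_injective (hmem hq1).1 (hmem hq2).1 (hmem hq1').1
      (hmem hq2').1 h
    exact Prod.ext e1 e2
  have hcard : R.card ^ 2 ≤ T.card := by
    calc R.card ^ 2 = (R ×ˢ R).card := by rw [Finset.card_product, sq]
      _ = ((R ×ˢ R).image fun q => squaredOfPair k l q.1 q.2).card :=
          (Finset.card_image_of_injOn hinj).symm
      _ ≤ T.card := Finset.card_le_card himage
  -- `T` is one of the terms of `squaredWalkCount (2n)`
  have hdiag : diag (k + l) ∈ box 2 (2 * n) := by
    rw [mem_box]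
    intro i
    simp only [diag]
    constructor <;> push_cast <;> omega
  refine hcard.trans ?_
  rw [squaredWalkCount]
  exact Finset.single_le_sum (f := fun v => (((zdGraph 2).finsetWalkLength (2 * n) (0 : Site 2)
    v).filter fun p => IsSquaredWalk p).card) (fun _ _ => Nat.zero_le _) hdiag

/-- The elementary estimate behind "one can increase `c` if necessary": for `n ≥ 1`,
`4 log(2n+1) ≤ 14 √n` (as `log y ≤ 2√y` and `8√3 < 14`). [folklore] -/
theorem four_mul_log_le (n : ℕ) (hn : 1 ≤ n) :
    4 * Real.log (2 * n + 1) ≤ 14 * Real.sqrt n := by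
  have hn' : (1 : ℝ) ≤ n := by exact_mod_cast hn
  have hy : (0 : ℝ) < 2 * n + 1 := by positivity
  -- `log y = 2 log √y ≤ 2 (√y - 1) ≤ 2 √y`
  have h1 : Real.log (2 * n + 1) ≤ 2 * Real.sqrt (2 * n + 1) := by
    have := Real.log_le_sub_one_of_pos (Real.sqrt_pos.2 hy)
    rw [Real.log_sqrt hy.le] at this
    linarith [Real.sqrt_nonneg (2 * (n : ℝ) + 1)]
  -- `√(2n+1) ≤ √3 √n` and `8 √3 ≤ 14`
  have h2 : Real.sqrt (2 * n + 1) ≤ Real.sqrt 3 * Real.sqrt n := by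
    rw [← Real.sqrt_mul (by norm_num : (0 : ℝ) ≤ 3)]
    exact Real.sqrt_le_sqrt (by linarith)
  have h3 : Real.sqrt 3 ≤ 7 / 4 := by
    rw [Real.sqrt_le_left (by norm_num)]
    norm_num
  have h4 : 0 ≤ Real.sqrt n := Real.sqrt_nonneg _
  nlinarith

/-- **Step 1 implies Lemma 5** (Duminil-Copin–Kozma–Yadin 2014, §2, proof of Lemma 5, Step 2):
if `#Σₙ ≥ e^{-c√n}μⁿ` for all `n`, then `aₙ ≥ μⁿe^{-c'√n}` for all even `n`, with
`c' = 2|c| + 14`: for `n = 2n'`, a pair `(k,l)` carrying `≥ #Σ_{n'}/(2n'+1)²` rectangle walks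
gives `a_{2n'} ≥ (e^{-c√n'}μ^{n'}/(2n'+1)²)² ≥ μ^{2n'} e^{-c'√(2n')}`
(`sq_card_rectangleWalksTo_le`, `four_mul_log_le`); `a₀ = 1`.
[cite: DuminilCopinKozmaYadin2014, Lemma 5] -/
theorem DKY2014_lem5_of_step1 (h : DKY2014_lem5_step1) : DKY2014_lem5 := by
  obtain ⟨c, hc⟩ := h
  refine ⟨2 * |c| + 14, fun N hN => ?_⟩
  obtain ⟨n, rfl⟩ := hN
  rcases Nat.eq_zero_or_pos n with rfl | hn
  · simp [squaredWalkCount_zero]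
  have hμ : 0 ≤ connectiveConstant := by
    rw [← Zd.connectiveConstant_two]; exact (Zd.connectiveConstant_pos 2).le
  -- Step 1 at `n`, and an endpoint `(k,l)` carrying many rectangle walks
  have hcn := hc n
  have hlow : 0 < Real.exp (-(c * Real.sqrt n)) * connectiveConstant ^ n := by
    have : 0 < connectiveConstant := by
      rw [← Zd.connectiveConstant_two]; exact Zd.connectiveConstant_pos 2
    positivity
  have hpos : 0 < rectangleWalkCount n := by exact_mod_cast hlow.trans_le hcn
  obtain ⟨k, l, hk, hl, hkl⟩ := exists_kl_rectangleWalkCount_le hpos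
  have hsq := sq_card_rectangleWalksTo_le hk hl
  -- the analytic comparison `μ^{2n} e^{-c'√(2n)} ≤ (e^{-c√n} μⁿ/(2n+1)²)²`
  have hn1 : (1 : ℝ) ≤ n := by exact_mod_cast hn
  have hden : (0 : ℝ) < (2 * n + 1) ^ 2 := by positivity
  have hlog := four_mul_log_le n hn
  have hsqrt2 : Real.sqrt n ≤ Real.sqrt (((n + n : ℕ) : ℝ)) :=
    Real.sqrt_le_sqrt (by push_cast; linarith)
  have hkey : -((2 * |c| + 14) * Real.sqrt (((n + n : ℕ) : ℝ))) ≤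
      -(2 * (c * Real.sqrt n)) - 4 * Real.log (2 * n + 1) := by
    have hc' : c * Real.sqrt n ≤ |c| * Real.sqrt n :=
      mul_le_mul_of_nonneg_right (le_abs_self c) (Real.sqrt_nonneg _)
    have h14 : 0 ≤ (2 * |c| + 14) := by positivity
    have := mul_le_mul_of_nonneg_left hsqrt2 h14
    nlinarith [Real.sqrt_nonneg (n : ℝ), abs_nonneg c]
  have hexp : Real.exp (-((2 * |c| + 14) * Real.sqrt (((n + n : ℕ) : ℝ)))) ≤
      Real.exp (-(c * Real.sqrt n)) ^ 2 / (2 * (n : ℝ) + 1) ^ 4 := by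
    have hy : (0 : ℝ) < 2 * n + 1 := by positivity
    have e1 : Real.exp (2 * -(c * Real.sqrt n) - 4 * Real.log (2 * n + 1)) =
        Real.exp (-(c * Real.sqrt n)) ^ 2 / (2 * (n : ℝ) + 1) ^ 4 := by
      rw [Real.exp_sub, show (2 : ℝ) * -(c * Real.sqrt n) = ((2 : ℕ) : ℝ) * -(c * Real.sqrt n) by
        norm_num, Real.exp_nat_mul, show (4 : ℝ) * Real.log (2 * n + 1) =
        ((4 : ℕ) : ℝ) * Real.log (2 * n + 1) by norm_num, Real.exp_nat_mul, Real.exp_log hy]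
    rw [← e1, Real.exp_le_exp]
    linarith
  -- assemble
  have hchain : (Real.exp (-(c * Real.sqrt n)) * connectiveConstant ^ n / (2 * n + 1) ^ 2) ^ 2 ≤
      squaredWalkCount (n + n) := by
    have h1 : Real.exp (-(c * Real.sqrt n)) * connectiveConstant ^ n / (2 * n + 1) ^ 2 ≤
        (rectangleWalksTo n (kl k l)).card := by
      rw [div_le_iff₀ hden]
      calc Real.exp (-(c * Real.sqrt n)) * connectiveConstant ^ n ≤ rectangleWalkCount n := hcn
        _ ≤ (2 * n + 1) ^ 2 * (rectangleWalksTo n (kl k l)).card := by exact_mod_cast hkl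
        _ = (rectangleWalksTo n (kl k l)).card * (2 * n + 1) ^ 2 := by ring
    calc (Real.exp (-(c * Real.sqrt n)) * connectiveConstant ^ n / (2 * n + 1) ^ 2) ^ 2
        ≤ ((rectangleWalksTo n (kl k l)).card : ℝ) ^ 2 :=
          pow_le_pow_left₀ (by positivity) h1 2
      _ ≤ squaredWalkCount (2 * n) := by exact_mod_cast hsq
      _ = squaredWalkCount (n + n) := by rw [two_mul]
  calc connectiveConstant ^ (n + n) * Real.exp (-((2 * |c| + 14) * Real.sqrt (((n + n : ℕ) : ℝ))))
      ≤ connectiveConstant ^ (n + n) *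
          (Real.exp (-(c * Real.sqrt n)) ^ 2 / (2 * (n : ℝ) + 1) ^ 4) :=
        mul_le_mul_of_nonneg_left hexp (pow_nonneg hμ _)
    _ = (Real.exp (-(c * Real.sqrt n)) * connectiveConstant ^ n / (2 * n + 1) ^ 2) ^ 2 := by
        rw [pow_add]
        field_simp
    _ ≤ squaredWalkCount (n + n) := hchain


/-! ### Step 1 in bridge form -/

/-- **Step 1 of the printed proof of Lemma 5, bridge form** (named fact; the sharper statement the
source actually establishes before invoking (2.1)): "the cardinality of `Σₙ` is thus larger than
`e^{-c√n} bₙ`" — for some constant `c`, `#Σₙ ≥ e^{-c√n} bₙ` for every `n`, with `bₙ = bridgeCount n`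
the bridges of (2.1). (Printed proof: the unfolding map `f : Λₙ → Σₙ` of a bridge into the
rectangle spanned by its endpoints is at most `e^{c√n}`-to-one, the widths of the reflected
pieces being two strictly decreasing sequences partitioning an integer `≤ n`, counted by
Hardy–Ramanujan, Theorem 4.) [cite: DuminilCopinKozmaYadin2014, Lemma 5 (proof, Step 1)] -/
def DKY2014_lem5_step1_bridge : Prop :=
  ∃ c : ℝ, ∀ n : ℕ, Real.exp (-(c * Real.sqrt n)) * bridgeCount n ≤ rectangleWalkCount n

/-- The bridge form of Step 1 and the Hammersley–Welsh bound (2.1) give Step 1 as used above: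
`#Σₙ ≥ e^{-c√n} bₙ ≥ e^{-(c+c')√n} μⁿ`. [cite: DuminilCopinKozmaYadin2014, Lemma 5 (proof, Step 1: "≥ e^{-c√n} bₙ ≥ e^{-2c√n} μⁿ")] -/
theorem DKY2014_lem5_step1_of_bridge (h : DKY2014_lem5_step1_bridge) (h21 : DKY2014_eq21) :
    DKY2014_lem5_step1 := by
  obtain ⟨c, hc⟩ := h
  obtain ⟨c', hc'⟩ := h21
  refine ⟨c + c', fun n => ?_⟩
  have h1 := (hc' n).1
  have h2 := hc n
  have hexp : 0 ≤ Real.exp (-(c * Real.sqrt n)) := Real.exp_nonneg _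
  calc Real.exp (-((c + c') * Real.sqrt n)) * connectiveConstant ^ n
      = Real.exp (-(c * Real.sqrt n)) * (Real.exp (-(c' * Real.sqrt n)) * connectiveConstant ^ n) := by
        rw [← mul_assoc, ← Real.exp_add]; ring_nf
    _ ≤ Real.exp (-(c * Real.sqrt n)) * bridgeCount n := mul_le_mul_of_nonneg_left h1 hexp
    _ ≤ rectangleWalkCount n := h2

end Literature.Probability.RandomPlanarGeometry.SAW
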